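import Mathlib.Analysis.SpecialFunctions.Pow.Deriv
import Literature.Analysis.FluidPDE.SelfSimilarCollapseAnsatz
import HarnessLib

/-!
# The effective viscosity read on the AMPLITUDE clock: `ν_eff = ν · A^{2γ−1}` with `A = (T−t)⁻¹`,
# and its monotonicity dichotomy in `t` (rising iff `γ > ½`)

Topic `Literature/Analysis/FluidPDE`, namespace `Literature.Analysis.FluidPDE`. Corollaries of the
tree's `effectiveViscosity ν γ T t = ν (T − t)^{1−2γ}` (`SelfSimilarCollapseAnsatz.lean`); no new
definitions, no named facts, no data.

**Why.** Dynamic-rescaling engines do not read the clock `T − t` (the blow-up time is unknown while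
the computation runs); they read the AMPLIFICATION `A = ‖ω‖_∞(t)/‖ω‖_∞(0) ∝ (T − t)⁻¹` (the vorticity
rate of the ansatz is `(T−t)⁻¹` for every `γ`, `curl_selfSimilarCollapse`) and report the rescaled
viscosity `ν̃` against it. On that clock Hou's law "`ν = ν₀ (T−t)^{2c_l−1}`" [Hou2026 §1.1, §3] reads
`ν_eff = ν · A^{2γ−1}`, i.e. `log(ν_eff/ν) = (2γ − 1)·log A`: the log-slope of the effective viscosity
against the amplification is `2γ − 1`, positive (viscosity RISING along the collapse) iff `γ > ½`,
zero at Leray's `γ = ½`, negative iff `γ < ½`. The monotonicity statements below are the clock-free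
form of `tendsto_effectiveViscosity_atTop_of_half_lt` / `tendsto_effectiveViscosity_zero_of_lt_half`.

## WHAT THIS IS NOT
Exact algebra of the power-law ansatz only; nothing about Navier–Stokes solutions, and no claim that
any computed collapse follows the ansatz.
-/

noncomputable section

open Real Set

namespace Literature.Analysis.FluidPDE

variable {γ T s t ν : ℝ}

/-- **Amplitude clock.** For `t < T`, `ν_eff(t) = ν · A^{2γ − 1}` with `A = (T − t)⁻¹` (the
vorticity amplification rate of the ansatz). [cite: Hou2026, §1.1 (ν = ν₀(T−t)^{2c_l−1}) and §3] -/
theorem effectiveViscosity_eq_mul_inv_rpow (ht : t < T) (ν γ : ℝ) :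
    effectiveViscosity ν γ T t = ν * ((T - t)⁻¹) ^ (2 * γ - 1) := by
  have hpos : 0 < T - t := sub_pos.mpr ht
  rw [effectiveViscosity_apply, Real.inv_rpow hpos.le, ← Real.rpow_neg hpos.le]
  congr 1
  rw [neg_sub]

/-- **Log-slope `2γ − 1`.** For `ν > 0` and `t < T`:
`log (ν_eff(t) / ν) = (2γ − 1) · log ((T − t)⁻¹)`. [cite: Hou2026, §1.1 (ν = ν₀(T−t)^{2c_l−1}) and §3] -/
theorem log_effectiveViscosity_div (ht : t < T) (hν : 0 < ν) (γ : ℝ) :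
    Real.log (effectiveViscosity ν γ T t / ν) = (2 * γ - 1) * Real.log ((T - t)⁻¹) := by
  have hpos : 0 < T - t := sub_pos.mpr ht
  rw [effectiveViscosity_eq_mul_inv_rpow ht, mul_div_cancel_left₀ _ hν.ne',
    Real.log_rpow (inv_pos.mpr hpos)]

/-- The effective viscosity is positive for `ν > 0`, `t < T`. [cite: Hou2026, §1.1 and §3] -/
theorem effectiveViscosity_pos (ht : t < T) (hν : 0 < ν) (γ : ℝ) : 0 < effectiveViscosity ν γ T t := by
  rw [effectiveViscosity_apply]
  exact mul_pos hν (Real.rpow_pos_of_pos (sub_pos.mpr ht) _)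

/-- **Rising regime.** For `γ > ½` and `ν > 0` the effective viscosity is STRICTLY INCREASING in `t`
on `(−∞, T)`: viscosity grows monotonically along the collapse (clock-free form of
`tendsto_effectiveViscosity_atTop_of_half_lt`). [cite: Hou2026, §1.1 (ν = ν₀(T−t)^{2c_l−1}) and §3] -/
theorem strictMonoOn_effectiveViscosity_of_half_lt (hγ : 1 / 2 < γ) (hν : 0 < ν) (T : ℝ) :
    StrictMonoOn (effectiveViscosity ν γ T) (Iio T) := by
  intro s hs t ht hst
  simp only [mem_Iio] at hs ht
  simp only [effectiveViscosity_apply]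
  refine mul_lt_mul_of_pos_left ?_ hν
  have hneg : 1 - 2 * γ < 0 := by linarith
  exact Real.rpow_lt_rpow_of_neg (sub_pos.mpr ht) (by linarith) hneg

/-- **Falling regime.** For `γ < ½` and `ν > 0` the effective viscosity is STRICTLY DECREASING in `t`
on `(−∞, T)` (clock-free form of `tendsto_effectiveViscosity_zero_of_lt_half`). [cite: Hou2026, §1.1 (ν = ν₀(T−t)^{2c_l−1}) and §3] -/
theorem strictAntiOn_effectiveViscosity_of_lt_half (hγ : γ < 1 / 2) (hν : 0 < ν) (T : ℝ) :
    StrictAntiOn (effectiveViscosity ν γ T) (Iio T) := by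
  intro s hs t ht hst
  simp only [mem_Iio] at hs ht
  simp only [effectiveViscosity_apply]
  refine mul_lt_mul_of_pos_left ?_ hν
  have hposexp : 0 < 1 - 2 * γ := by linarith
  exact Real.rpow_lt_rpow (sub_pos.mpr ht).le (by linarith) hposexp

/-- **Leray's exponent is the constant case**: at `γ = ½` the effective viscosity does not move.
[cite: Hou2026, §1.1 and §3] -/
theorem effectiveViscosity_half_const (ν T s t : ℝ) :
    effectiveViscosity ν (1 / 2) T s = effectiveViscosity ν (1 / 2) T t := by
  rw [effectiveViscosity_half, effectiveViscosity_half]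

/-- **Dichotomy read from two clock readings.** For `ν > 0` and two times `s < t < T`:
`ν_eff(s) < ν_eff(t) ↔ ½ < γ` — a rising effective viscosity between ANY two instants of the collapse
certifies `γ > ½` (and a falling one `γ < ½`). [cite: Hou2026, §1.1 (ν = ν₀(T−t)^{2c_l−1}) and §3] -/
theorem effectiveViscosity_lt_iff_half_lt (hs : s < t) (ht : t < T) (hν : 0 < ν) :
    effectiveViscosity ν γ T s < effectiveViscosity ν γ T t ↔ 1 / 2 < γ := by
  constructor
  · intro h
    by_contra hle
    rw [not_lt] at hle
    rcases hle.lt_or_eq with hlt | heq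
    · exact (lt_asymm h) ((strictAntiOn_effectiveViscosity_of_lt_half hlt hν T) (show s ∈ Iio T from hs.trans ht) (show t ∈ Iio T from ht) hs)
    · rw [heq] at h
      exact (lt_irrefl _) (by rwa [effectiveViscosity_half_const ν T s t] at h)
  · intro hγ
    exact strictMonoOn_effectiveViscosity_of_half_lt hγ hν T (show s ∈ Iio T from hs.trans ht) (show t ∈ Iio T from ht) hs

end Literature.Analysis.FluidPDE
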